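import Summits.HodgeConjecture.HodgeConjecture.Theorems.CyclicUnitaryPowersFermatGeometricGenusBound
import Literature.AlgebraicGeometry.HodgeTheory.SmoothHypersurfacesHomeomorphic

/-!
# The geometric genus of a smooth surface of odd degree `d ≥ 5` in `ℙ³` is `C(d-1, 3)` (programme PG-FERMAT, corollary)

Prover seat `hodge-nonav-prover-Bx` (g10), cell `hodge-nonav`, crux K1-A (stmt-HodgeConjecture-19544). The registry stub PG
(`Arapura2012_hypersurface_geometricGenus`: `h^{n,0}(X_F) = C(d-1, n+1)` for smooth hypersurfaces) is no longer needed by K1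
(`veryGeneralDeckCommutatorsInHg_of_localMonodromyBound_cdk`), but programme PG-FERMAT also PROVES a large part of its `n = 2` clause:

* `hodgeNumber_two_zero_fermat_eq_choose` — **`h^{2,0}(X²_d) = C(d-1, 3)` for the Fermat surface of every degree `d ≥ 4`**
  (upper bound `hodgeNumber_two_zero_fermat_le`, lower bound by Griffiths' residues `choose_le_geometricGenus`); Shioda (1.7).
* `Arapura2012_hypersurface_geometricGenus_two_odd` — **the `n = 2` clause of the named fact for every ODD degree `d ≥ 5`**:
  smooth surfaces of the same odd degree are homeomorphic with `b₂` odd, so `h^{2,0}` is constant among them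
  (`hodgeNumber_two_zero_hypersurface_eq_choose_of_odd_of_fermat`), and the Fermat surface has the value.
  (The `n = 1` clause is `Arapura2012_hypersurface_geometricGenus_one`; even `d` and `d ≤ 3` remain.)

Sorry-free; no definition, no named fact; helper (`--supports stmt-HodgeConjecture-19544`); nothing here says HC ∕ HC_AV is proved.
[cite: Shioda1979HodgeFermat, §1 (1.7)] [cite: Arapura2012, §17.3 (17.3.1) and Cor. 17.3.5]
-/

noncomputable section

set_option linter.dupNamespace false

namespace Summit.HodgeConjecture.HodgeConjecture.Theorems.CyclicUnitaryPowersSurfaceGeometricGenusOdd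

open Literature.AlgebraicGeometry.HodgeTheory Literature.AlgebraicGeometry.Motives
  Summit.HodgeConjecture.HodgeConjecture.Theorems.CyclicUnitaryPowersFermatGeometricGenusBound

/-- **`h^{2,0}(X²_d) = C(d-1, 3)`** for the Fermat surface `x₀ᵈ + ⋯ + x₃ᵈ = 0` of every degree `d ≥ 4` (Shioda (1.7): the
holomorphic `2`-forms are the residues `Res(x^{b-1}Ω/F)`, `bᵢ ≥ 1`, `Σ bᵢ = d`). [cite: Shioda1979HodgeFermat, §1 (1.7)]
[cite: VoisinHodgeII2003, §6.1.3 Cor. 6.12 (p = 1)] -/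
theorem hodgeNumber_two_zero_fermat_eq_choose {d : ℕ} (hd : 4 ≤ d) (hHD : exists_isReal_hodgeModel)
    (hX : IsSmoothProjective 2 (fermatHypersurface 2 d)) :
    (BettiUniverse.hodge hHD hX 2).hodgeNumber 2 0 = Nat.choose (d - 1) 3 := by
  haveI : NeZero d := ⟨by omega⟩
  refine le_antisymm (hodgeNumber_two_zero_fermat_le hd hHD hX) ?_
  exact choose_le_geometricGenus hHD (n := 2) (by norm_num) (isHomogeneous_fermatPolynomial 2 d)
    (SmoothHypersurface.isNonsingularForm_sum_X_pow (Nat.cast_ne_zero.mpr (NeZero.ne d))) hX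

/-- **The `n = 2`, odd `d ≥ 5` clause of the named fact `Arapura2012_hypersurface_geometricGenus`, PROVED**: for a nonsingular
quaternary form `F` of odd degree `d ≥ 5` with `X_F` smooth projective of dimension `2`, `dim_ℂ H^{2,0}(X_F) = C(d-1, 3)` —
literally the fact's body at `n = 2`. [cite: Arapura2012, §17.3 (17.3.1) and Cor. 17.3.5] [cite: Shioda1979HodgeFermat, §1 (1.7)]
[cite: HuybrechtsCG2005, §3.3 Cor. 3.3.16] -/
theorem Arapura2012_hypersurface_geometricGenus_two_odd (hHD : exists_isReal_hodgeModel) ⦃d : ℕ⦄ (hd : Odd d) (h5 : 5 ≤ d)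
    (F : MvPolynomial (Fin (2 + 2)) ℂ) (hF : F.IsHomogeneous d) (hJ : SmoothHypersurface.IsNonsingularForm ℂ F)
    (hX : IsSmoothProjective 2 (SmoothHypersurface.hypersurface F)) :
    Module.finrank ℂ ↥((BettiUniverse.hodge hHD hX 2).piece (2 : ℤ) 0) = Nat.choose (d - 1) (2 + 1) := by
  have hXd : IsSmoothProjective 2 (fermatHypersurface 2 d) := isSmoothProjective_fermatHypersurface (by norm_num) (by omega)
  exact hodgeNumber_two_zero_hypersurface_eq_choose_of_odd_of_fermat hHD hd hXd
    (hodgeNumber_two_zero_fermat_eq_choose (by omega) hHD hXd) F hF hJ hX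

end Summit.HodgeConjecture.HodgeConjecture.Theorems.CyclicUnitaryPowersSurfaceGeometricGenusOdd

end
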